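import Summits.AtomisticToContinuum.HydrodynamicLimit.Theorems.JParityClosureRateFloorPairFunctionalUpperInProb
import HarnessLib

/-!
# The B-side of `RateFloor` at rung 0, VI: the in-probability LOWER bound for the time-integrated, χ-weighted pair functional
# along the flow (helper file, `--supports stmt-AtomisticToContinuum-13080`)

Crux `JParityClosure.RateFloor` (stmt-AtomisticToContinuum-13080).  File V (`RateFloorPairFunctionalUpper`) landed the UPPER bound
`G_N {Θ̄_Ξ ∫₀^τ∫χ + η < ∫₀^τ∫ χ B_r Ξ (Φ_s z, ·)} ≤ δ`; this file is its LOWER twin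

  `G_N {z | ∫₀^τ ∫ χ(s, x) B_r Ξ (Φ_s z, x) dx ds < Θ̄_Ξ ∫₀^τ∫ χ − η} ≤ δ`   (`pairFunctional_lower_inProb_rung0`, eventually in `N`),

`Θ̄_Ξ = ∫ Θ Ξ d(N(u,θ) ⊗ N(u,θ))`, `B_r Ξ (z, x) = pairFunctional r Ξ z x` (verbatim the crux's `B Ξ z s x` at `z ↦ Φ_s z`), for constant profiles
at small reduced density, every family of flows, `τ > 0`, continuous `χ ≥ 0`, continuous `0 ≤ Ξ ≤ C`, `0 < r < 1/2`.  Together the two files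
are the two-sided law of large numbers, in `G_N`-probability, for the crux's r-mollified ideal functional at global equilibrium — the input
through which (i) the reference mean `M_{r,N} = ∫₀^τ E_G[∫χ B_r] ds` of the anchored door (`Cruxes/RateFloor/RateFloorDoorC11.lean`, stubs
`RefPlateau`/`RefRealisedFloor`) is compared with the empirical functional at rung 0, and (ii) a would-be / realised floor stated against
`Θ̄∫∫χ` (`RateFloorStaticFloor.stub_staticOpacityFloorRung0`) is read against the empirical functional and conversely.
Ingredients: the same static `L¹` bound `integral_abs_pairFunctional_sub_le` (file IV) made eventually-`ε₀` exactly as in file V, the static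
mean of the deviation functional `lintegral_devFunctional_le`, the one-sided Markov transfer along the flow
`measure_lt_setIntegral_flow_le_of_nonneg` (Gibbs invariance), and — the only new point — integrability in time of
`s ↦ ∫ χ(s,x) B_r Ξ (Φ_s z, x) dx` along GOOD orbits (measurable by `measurable_piecewise_flow_torus`, bounded by energy conservation
`pairFunctional_flow_le_of_mem_good`), so that `Θ̄∫∫χ − ∫∫χB ≤ ∫∫χ|B − Θ̄|` holds for the Bochner time integrals without junk.
-/

noncomputable section

open MeasureTheory ProbabilityTheory Set Filter Topology
open scoped ENNReal InnerProductSpace BigOperators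

namespace Summit.AtomisticToContinuum.HydrodynamicLimit.Theorems

namespace RateFloorPairFunctionalLower

open Literature.Analysis.FluidPDE Literature.MathematicalPhysics.KineticTheory
open Literature.Probability.Moments
open Summit.AtomisticToContinuum.HydrodynamicLimit.Theorems.EvenStressEnskog
open RateFloorMarkovFlowTransfer RateFloorPairFunctionalUpper

/-- The χ-weighted pair functional `(s, z) ↦ ∫ χ(s, x) B_r Ξ (z, x) dx` is jointly continuous (parametric integral of a jointly continuous
integrand over the compact torus). [folklore] -/
theorem continuous_weightedPairFunctional {N : ℕ} (r : ℝ) {Ξ : V3 × V3 × V3 → ℝ} (hΞc : Continuous Ξ)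
    {χ : ℝ × T3 → ℝ} (hχ : Continuous χ) :
    Continuous fun p : ℝ × Config (N + 1) (Fin 3) T3 => ∫ x : T3, χ (p.1, x) * pairFunctional r Ξ p.2 x := by
  have hF : Continuous (Function.uncurry fun (p : ℝ × Config (N + 1) (Fin 3) T3) (x : T3) =>
      χ (p.1, x) * pairFunctional r Ξ p.2 x) := by
    have h1 : Continuous fun q : (ℝ × Config (N + 1) (Fin 3) T3) × T3 => χ (q.1.1, q.2) :=
      hχ.comp (continuous_fst.fst.prodMk continuous_snd)
    have h2 : Continuous fun q : (ℝ × Config (N + 1) (Fin 3) T3) × T3 => pairFunctional r Ξ q.1.2 q.2 :=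
      continuous_pairFunctional_comp r hΞc continuous_fst.snd continuous_snd
    exact h1.mul h2
  have h := continuous_parametric_integral_of_continuous (μ := (volume : Measure T3)) hF isCompact_univ
  simpa only [Measure.restrict_univ] using h

/-- **The lower B-side event along the flow, bounded by Markov** (rung 0): if `E_G|B_r Ξ (·, x₀) − Θ̄_Ξ| ≤ e` for every base point,
`0 ≤ χ ≤ C_χ` on `[0, τ] × 𝕋³`, `τ, η > 0`, then
`G {z | ∫₀^τ∫ χ(s,x) B_r Ξ (Φ_s z, x) dx ds < Θ̄_Ξ ∫₀^τ∫χ − η} ≤ ofReal (τ C_χ e / η)`.  Along a good orbit the time integrand is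
measurable and bounded (energy conservation), hence Bochner-integrable on `[0, τ]`, so `Θ̄∫∫χ − ∫∫χB ≤ ∫∫χ|B − Θ̄|`; the right side is
controlled by the one-sided Markov transfer along the flow. [folklore] -/
theorem measure_timeIntegral_pairFunctional_lt_le {σ a θ : ℝ} {u : V3} (hσ2 : σ ≤ 1 / 2) (ha : 0 < a) (hθ : 0 < θ)
    {Ξ : V3 × V3 × V3 → ℝ} (hΞc : Continuous Ξ) (hΞ0 : ∀ q, 0 ≤ Ξ q) {C : ℝ} (hΞC : ∀ q, Ξ q ≤ C)
    {r : ℝ} (hr : 0 < r) (N : ℕ) (Φ : HardSphereFlow (Torus.geometry (Fin 3)) (hsDiameter σ N) (N + 1))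
    {χ : ℝ × T3 → ℝ} (hχ : Continuous χ) (hχ0 : ∀ p, 0 ≤ χ p) {τ η e Cχ : ℝ}
    (hχC : ∀ s ∈ Icc (0 : ℝ) τ, ∀ x, χ (s, x) ≤ Cχ) (hτ : 0 < τ) (hη : 0 < η)
    (he : ∀ x₀ : T3, ∫ z, |pairFunctional r Ξ z x₀ - ∫ p, sphereMark Ξ p.1 p.2 ∂((gaussMeasure u θ).prod (gaussMeasure u θ))|
      ∂(localGibbsLaw σ (fun _ => a) (fun _ => u) (fun _ => θ) N Φ) ≤ e) :
    localGibbsLaw σ (fun _ => a) (fun _ => u) (fun _ => θ) N Φ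
        {z | ∫ s in Icc (0 : ℝ) τ, ∫ x : T3, χ (s, x) * pairFunctional r Ξ (Φ.flow s z) x <
            (∫ p, sphereMark Ξ p.1 p.2 ∂((gaussMeasure u θ).prod (gaussMeasure u θ))) *
              (∫ s in Icc (0 : ℝ) τ, ∫ x : T3, χ (s, x)) - η} ≤
      ENNReal.ofReal (τ * (Cχ * e) / η) := by
  classical
  set G := localGibbsLaw σ (fun _ => a) (fun _ => u) (fun _ => θ) N Φ with hG
  set Θb : ℝ := ∫ p, sphereMark Ξ p.1 p.2 ∂((gaussMeasure u θ).prod (gaussMeasure u θ)) with hΘb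
  haveI : IsProbabilityMeasure G := isProbabilityMeasure_localGibbsLaw continuous_const continuous_const continuous_const
    (fun _ => ha) (fun _ => hθ) hσ2 N Φ
  have hΘb0 : 0 ≤ Θb := integral_nonneg fun p => sphereMark_nonneg' hΞ0 p.1 p.2
  -- the deviation functional
  set A : ℝ → Config (N + 1) (Fin 3) T3 → ℝ := fun s z => ∫ x : T3, χ (s, x) * |pairFunctional r Ξ z x - Θb| with hA
  have hAc : Continuous fun p : ℝ × Config (N + 1) (Fin 3) T3 => A p.1 p.2 := continuous_devFunctional r hΞc hχ Θb
  have hA0 : ∀ s z, 0 ≤ A s z := fun s z => integral_nonneg fun x => mul_nonneg (hχ0 _) (abs_nonneg _)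
  have hmean : ∀ t ∈ Icc (0 : ℝ) τ, ∫⁻ z, ENNReal.ofReal (A t z) ∂G ≤ ENNReal.ofReal (Cχ * e) := fun t ht =>
    lintegral_devFunctional_le (u := u) hσ2 ha hθ hΞc hΞ0 hΞC hr N Φ hχ t (fun x => hχ0 _) (hχC t ht) Θb he
  have hmarkov := measure_lt_setIntegral_flow_le_of_nonneg σ ha hθ u hσ2 N Φ hAc.measurable hA0 hτ hη hmean
  refine le_trans (measure_mono_ae ?_) hmarkov
  -- `G`-a.e. configuration is good; on good configurations the event forces `η < ∫ A_s (Φ_s z)`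
  have hgood : ∀ᵐ z ∂G, z ∈ Φ.good := by
    rw [hG, localGibbsLaw_eq]
    exact (localGibbsMeasure_absolutelyContinuous σ _ _ _ N Φ).ae_le Φ.ae_mem_good
  filter_upwards [hgood] with z hz hev
  -- the three time functions
  set f : ℝ → ℝ := fun s => ∫ x : T3, χ (s, x) * pairFunctional r Ξ (Φ.flow s z) x with hf
  set g : ℝ → ℝ := fun s => ∫ x : T3, χ (s, x) with hg
  set h : ℝ → ℝ := fun s => A s (Φ.flow s z) with hh
  -- pointwise in `s`: `Θb * g s - f s ≤ h s`
  have hx_int : ∀ s, Integrable (fun x : T3 => χ (s, x) * pairFunctional r Ξ (Φ.flow s z) x) volume := fun s =>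
    ((hχ.comp (Continuous.prodMk_right s)).mul
      (continuous_pairFunctional_comp r hΞc continuous_const continuous_id)).integrable_of_hasCompactSupport
        (isClosed_tsupport _).isCompact
  have hxg_int : ∀ s, Integrable (fun x : T3 => χ (s, x)) volume := fun s =>
    (hχ.comp (Continuous.prodMk_right s)).integrable_of_hasCompactSupport (isClosed_tsupport _).isCompact
  have hxa_int : ∀ s, Integrable (fun x : T3 => χ (s, x) * |pairFunctional r Ξ (Φ.flow s z) x - Θb|) volume := fun s =>
    ((hχ.comp (Continuous.prodMk_right s)).mul
      (((continuous_pairFunctional_comp r hΞc continuous_const continuous_id).sub continuous_const).abs)).integrable_of_hasCompactSupport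
        (isClosed_tsupport _).isCompact
  have hpt : ∀ s, Θb * g s - f s ≤ h s := fun s => by
    simp only [hf, hg, hh, hA]
    rw [← integral_const_mul, ← integral_sub ((hxg_int s).const_mul Θb) (hx_int s)]
    refine integral_mono (((hxg_int s).const_mul Θb).sub (hx_int s)) (hxa_int s) fun x => ?_
    have e1 : Θb * χ (s, x) - χ (s, x) * pairFunctional r Ξ (Φ.flow s z) x =
        χ (s, x) * (Θb - pairFunctional r Ξ (Φ.flow s z) x) := by
      ring
    rw [e1]
    exact mul_le_mul_of_nonneg_left ((le_abs_self _).trans_eq (abs_sub_comm _ _)) (hχ0 _)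
  -- `f`, `h` are measurable and bounded on `[0, τ]`, hence integrable there; `g` is continuous
  have hflow_m : Measurable fun s : ℝ => Φ.flow s z := by
    have h1 : Measurable fun s : ℝ => Φ.good.piecewise (Φ.flow s) id z :=
      (measurable_piecewise_flow_torus Φ).comp (measurable_id.prodMk (measurable_const (a := z)))
    have e : (fun s : ℝ => Φ.good.piecewise (Φ.flow s) id z) = fun s : ℝ => Φ.flow s z := by
      funext s
      exact piecewise_flow_of_mem Φ s hz
    rwa [e] at h1
  have hhm : Measurable h := hAc.measurable.comp (measurable_id.prodMk hflow_m)
  have hfm : Measurable f := (continuous_weightedPairFunctional r hΞc hχ).measurable.comp (measurable_id.prodMk hflow_m)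
  have hCχ0 : 0 ≤ Cχ := (hχ0 (0, 0)).trans (hχC 0 ⟨le_rfl, hτ.le⟩ 0)
  set Kz : ℝ := (3 / (Real.pi * r ^ 3)) ^ 2 * (C * (sphereMeasure : Measure (Metric.sphere (0 : V3) 1)).real univ) *
    (1 / 2 + 4 * ((((N + 1 : ℕ) : ℝ))⁻¹ * configEnergy z)) with hKz
  have hhb : ∀ s ∈ Icc (0 : ℝ) τ, |h s| ≤ Cχ * (Kz + Θb) := by
    intro s hs
    rw [abs_of_nonneg (hA0 _ _)]
    show ∫ x : T3, χ (s, x) * |pairFunctional r Ξ (Φ.flow s z) x - Θb| ≤ Cχ * (Kz + Θb)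
    have hB : ∀ x : T3, |pairFunctional r Ξ (Φ.flow s z) x - Θb| ≤ Kz + Θb := fun x => by
      refine (abs_sub _ _).trans (add_le_add ?_ (le_of_eq (abs_of_nonneg hΘb0)))
      rw [abs_of_nonneg (pairFunctional_nonneg hr hΞ0 _ _)]
      exact pairFunctional_flow_le_of_mem_good hr hΞc hΞ0 hΞC Φ hz s x
    calc ∫ x : T3, χ (s, x) * |pairFunctional r Ξ (Φ.flow s z) x - Θb|
        ≤ ∫ _x : T3, Cχ * (Kz + Θb) := integral_mono (hxa_int s) (integrable_const _) fun x =>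
            mul_le_mul (hχC s hs x) (hB x) (abs_nonneg _) hCχ0
      _ = Cχ * (Kz + Θb) := by rw [integral_const, smul_eq_mul, probReal_univ, one_mul]
  have hfb : ∀ s ∈ Icc (0 : ℝ) τ, |f s| ≤ Cχ * Kz := by
    intro s hs
    have hf0 : 0 ≤ f s := integral_nonneg fun x => mul_nonneg (hχ0 _) (pairFunctional_nonneg hr hΞ0 _ _)
    rw [abs_of_nonneg hf0]
    show ∫ x : T3, χ (s, x) * pairFunctional r Ξ (Φ.flow s z) x ≤ Cχ * Kz
    calc ∫ x : T3, χ (s, x) * pairFunctional r Ξ (Φ.flow s z) x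
        ≤ ∫ _x : T3, Cχ * Kz := integral_mono (hx_int s) (integrable_const _) fun x =>
            mul_le_mul (hχC s hs x) (pairFunctional_flow_le_of_mem_good hr hΞc hΞ0 hΞC Φ hz s x)
              (pairFunctional_nonneg hr hΞ0 _ _) hCχ0
      _ = Cχ * Kz := by rw [integral_const, smul_eq_mul, probReal_univ, one_mul]
  have hh_int : IntegrableOn h (Icc (0 : ℝ) τ) volume := by
    refine Measure.integrableOn_of_bounded (M := Cχ * (Kz + Θb)) (measure_Icc_lt_top.ne) hhm.aestronglyMeasurable ?_
    rw [ae_restrict_iff' measurableSet_Icc]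
    exact ae_of_all _ fun s hs => by rw [Real.norm_eq_abs]; exact hhb s hs
  have hf_int : IntegrableOn f (Icc (0 : ℝ) τ) volume := by
    refine Measure.integrableOn_of_bounded (M := Cχ * Kz) (measure_Icc_lt_top.ne) hfm.aestronglyMeasurable ?_
    rw [ae_restrict_iff' measurableSet_Icc]
    exact ae_of_all _ fun s hs => by rw [Real.norm_eq_abs]; exact hfb s hs
  have hg_int : IntegrableOn g (Icc (0 : ℝ) τ) volume := by
    have hgc : Continuous g := by
      have hF : Continuous (Function.uncurry fun (s : ℝ) (x : T3) => χ (s, x)) := hχ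
      have h := continuous_parametric_integral_of_continuous (μ := (volume : Measure T3)) hF isCompact_univ
      simpa only [Measure.restrict_univ, hg] using h
    exact hgc.continuousOn.integrableOn_compact isCompact_Icc
  have h1 : Θb * (∫ s in Icc (0 : ℝ) τ, g s) - ∫ s in Icc (0 : ℝ) τ, f s ≤ ∫ s in Icc (0 : ℝ) τ, h s := by
    rw [← integral_const_mul, ← integral_sub (hg_int.const_mul Θb) hf_int]
    exact integral_mono ((hg_int.const_mul Θb).sub hf_int) hh_int hpt
  have hev' : ∫ s in Icc (0 : ℝ) τ, f s < Θb * (∫ s in Icc (0 : ℝ) τ, g s) - η := hev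
  show η < ∫ s in Icc (0 : ℝ) τ, h s
  linarith

/-! ## The in-probability lower bound for the B-side, eventually in `N` -/

/-- **The B-side of `RateFloor` at rung 0, LOWER bound in probability.**  For constant profiles `a, θ > 0`, `u`, at small reduced density
(`SmallDensity uniformProfile σ`), every family of flows, `τ > 0`, continuous `χ ≥ 0`, continuous `0 ≤ Ξ ≤ C`, `0 < r < 1/2` and
`η, δ > 0`, eventually in `N`:
`G_N {z | ∫₀^τ∫ χ(s, x) B_r Ξ (Φ_s z, x) dx ds < Θ̄_Ξ ∫₀^τ∫χ − η} ≤ δ`, `Θ̄_Ξ = ∫ Θ Ξ d(N(u,θ) ⊗ N(u,θ))`.  The static `L¹` deviation is made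
`≤ ε₀ = δη/(τ(C_χ+1))` exactly as in the upper twin `pairFunctional_upper_inProb_rung0` (speed cutoff `L`, splitting parameters `η₁, η₂`,
remainder `→ 0` by `tendsto_integral_sq_empDensity_sub_one`). [folklore] -/
theorem pairFunctional_lower_inProb_rung0 {σ a θ : ℝ} {u : V3} (hsd : SmallDensity uniformProfile σ) (ha : 0 < a) (hθ : 0 < θ)
    (Φ : (N : ℕ) → HardSphereFlow (Torus.geometry (Fin 3)) (hsDiameter σ N) (N + 1)) {τ : ℝ} (hτ : 0 < τ)
    {χ : ℝ × T3 → ℝ} (hχ : Continuous χ) (hχ0 : ∀ p, 0 ≤ χ p)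
    {Ξ : V3 × V3 × V3 → ℝ} (hΞc : Continuous Ξ) (hΞ0 : ∀ q, 0 ≤ Ξ q) {C : ℝ} (hΞC : ∀ q, Ξ q ≤ C)
    {r : ℝ} (hr : 0 < r) (hr2 : r < 1 / 2) {η δ : ℝ} (hη : 0 < η) (hδ : 0 < δ) :
    ∃ N₀ : ℕ, ∀ N : ℕ, N₀ ≤ N →
      localGibbsLaw σ (fun _ => a) (fun _ => u) (fun _ => θ) N (Φ N)
        {z | ∫ s in Icc (0 : ℝ) τ, ∫ x : T3, χ (s, x) * pairFunctional r Ξ ((Φ N).flow s z) x <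
            (∫ p, sphereMark Ξ p.1 p.2 ∂((gaussMeasure u θ).prod (gaussMeasure u θ))) *
              (∫ s in Icc (0 : ℝ) τ, ∫ x : T3, χ (s, x)) - η} ≤ ENNReal.ofReal δ := by
  have hσ2 : σ ≤ 1 / 2 := hsd.σ_lt_half.le
  obtain ⟨Cχ, hCχ0, hχC⟩ := exists_bound_on_slab' χ hχ τ
  -- the target accuracy for the static `L¹` deviation
  obtain ⟨ε₀, hε₀def⟩ : ∃ ε₀ : ℝ, ε₀ = δ * η / (τ * (Cχ + 1)) := ⟨_, rfl⟩
  have hε₀ : 0 < ε₀ := by rw [hε₀def]; positivity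
  -- constants (kept literal so that the four-term bound is matched syntactically)
  have hM0 : 0 ≤ 3 / (Real.pi * r ^ 3) := by positivity
  have hS0 : 0 ≤ (sphereMeasure : Measure (Metric.sphere (0 : V3) 1)).real univ := measureReal_nonneg
  have hC0 : 0 ≤ C := (hΞ0 0).trans (hΞC 0)
  have hm₂0 : 0 ≤ ‖u‖ ^ 2 + 3 * θ := by positivity
  obtain ⟨X, hXdef⟩ : ∃ X : ℝ, X = (4 * (3 / (Real.pi * r ^ 3)) ^ 2 + 4) * C *
      (sphereMeasure : Measure (Metric.sphere (0 : V3) 1)).real univ * (‖u‖ ^ 2 + 3 * θ) := ⟨_, rfl⟩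
  have hX0 : 0 ≤ X := by rw [hXdef]; positivity
  -- the speed cutoff `L`
  obtain ⟨L, hLdef⟩ : ∃ L : ℝ, L = 4 * X / ε₀ + 1 := ⟨_, rfl⟩
  have hL0 : 0 < L := by rw [hLdef]; positivity
  have htail : 4 * (3 / (Real.pi * r ^ 3)) ^ 2 * (C * (sphereMeasure : Measure (Metric.sphere (0 : V3) 1)).real univ / L) *
      (‖u‖ ^ 2 + 3 * θ) + C * (sphereMeasure : Measure (Metric.sphere (0 : V3) 1)).real univ / L * (4 * (‖u‖ ^ 2 + 3 * θ)) ≤ ε₀ / 4 := by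
    have e : 4 * (3 / (Real.pi * r ^ 3)) ^ 2 * (C * (sphereMeasure : Measure (Metric.sphere (0 : V3) 1)).real univ / L) *
        (‖u‖ ^ 2 + 3 * θ) + C * (sphereMeasure : Measure (Metric.sphere (0 : V3) 1)).real univ / L * (4 * (‖u‖ ^ 2 + 3 * θ)) =
        X / L := by rw [hXdef]; field_simp
    rw [e, div_le_div_iff₀ hL0 (by norm_num : (0 : ℝ) < 4)]
    have : ε₀ * L = 4 * X + ε₀ := by rw [hLdef]; field_simp
    nlinarith
  -- `η₁, η₂`
  obtain ⟨η₁, hη₁def⟩ : ∃ η₁ : ℝ, η₁ = ε₀ / 4 := ⟨_, rfl⟩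
  have hη₁0 : 0 < η₁ := by rw [hη₁def]; positivity
  have hη₁half : η₁ / 2 = ε₀ / 8 := by rw [hη₁def]; ring
  have hCΘ0 : 0 ≤ C * (2 * L) * (sphereMeasure : Measure (Metric.sphere (0 : V3) 1)).real univ := by positivity
  obtain ⟨η₂, hη₂def⟩ : ∃ η₂ : ℝ, η₂ = ε₀ / (8 * (C * (2 * L) * (sphereMeasure : Measure (Metric.sphere (0 : V3) 1)).real univ *
      (3 / (Real.pi * r ^ 3) + 1) + 1)) := ⟨_, rfl⟩
  have hden : 0 < C * (2 * L) * (sphereMeasure : Measure (Metric.sphere (0 : V3) 1)).real univ * (3 / (Real.pi * r ^ 3) + 1) + 1 := by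
    positivity
  have hη₂0 : 0 < η₂ := by rw [hη₂def]; positivity
  have hT2 : C * (2 * L) * (sphereMeasure : Measure (Metric.sphere (0 : V3) 1)).real univ * (3 / (Real.pi * r ^ 3) + 1) * η₂ ≤
      ε₀ / 8 := by
    rw [hη₂def, ← mul_div_assoc, div_le_div_iff₀ (by positivity) (by norm_num : (0 : ℝ) < 8)]
    nlinarith [mul_nonneg hCΘ0 (by linarith : (0 : ℝ) ≤ 3 / (Real.pi * r ^ 3) + 1), hε₀.le]
  -- the `N`-remainder tends to `0`
  have hVlim : Tendsto (fun N : ℕ => ∫ xs, (empDensity r xs 0 - 1) ^ 2 ∂posGibbsMeasure (fun _ : T3 => a) (hsDiameter σ N) (N + 1))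
      atTop (𝓝 0) := tendsto_integral_sq_empDensity_sub_one hsd ha hr hr2 0
  have hRlim := tendsto_remainder hVlim (8 * (3 / (Real.pi * r ^ 3)) ^ 4 *
      (C * (2 * L) * (sphereMeasure : Measure (Metric.sphere (0 : V3) 1)).real univ) ^ 2)
    (C * (2 * L) * (sphereMeasure : Measure (Metric.sphere (0 : V3) 1)).real univ * (3 / (Real.pi * r ^ 3) + 1))
    (C * (2 * L) * (sphereMeasure : Measure (Metric.sphere (0 : V3) 1)).real univ * (3 / (Real.pi * r ^ 3)) ^ 2) η₁ η₂
  obtain ⟨N₀, hN₀⟩ := Filter.eventually_atTop.1 (hRlim.eventually (gt_mem_nhds (by positivity : (0 : ℝ) < ε₀ / 4)))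
  refine ⟨N₀, fun N hN => ?_⟩
  -- the static deviation at every base point is `≤ ε₀`
  have he : ∀ x₀ : T3, ∫ z, |pairFunctional r Ξ z x₀ - ∫ p, sphereMark Ξ p.1 p.2 ∂((gaussMeasure u θ).prod (gaussMeasure u θ))|
      ∂(localGibbsLaw σ (fun _ => a) (fun _ => u) (fun _ => θ) N (Φ N)) ≤ ε₀ := by
    intro x₀
    have h := integral_abs_pairFunctional_sub_le (u := u) hσ2 ha hθ hΞc hΞ0 hΞC hr x₀ N (Φ N) hL0 hη₁0 hη₂0
    rw [integral_sq_empDensity_sub_one_eq a (hsDiameter σ N) r (N + 1) x₀] at h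
    have hRN := hN₀ N hN
    have hRN' : 8 * (3 / (Real.pi * r ^ 3)) ^ 4 *
          (C * (2 * L) * (sphereMeasure : Measure (Metric.sphere (0 : V3) 1)).real univ) ^ 2 * (((N + 1 : ℕ) : ℝ))⁻¹ / (2 * η₁) +
        C * (2 * L) * (sphereMeasure : Measure (Metric.sphere (0 : V3) 1)).real univ * (3 / (Real.pi * r ^ 3) + 1) *
          ((∫ xs, (empDensity r xs 0 - 1) ^ 2 ∂posGibbsMeasure (fun _ : T3 => a) (hsDiameter σ N) (N + 1)) / (4 * η₂)) +
        C * (2 * L) * (sphereMeasure : Measure (Metric.sphere (0 : V3) 1)).real univ * (3 / (Real.pi * r ^ 3)) ^ 2 *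
          (((N + 1 : ℕ) : ℝ))⁻¹ < ε₀ / 4 := by
      simpa only [mul_assoc] using hRN
    exact h.trans (fourTerm_le_of_bounds hε₀.le htail hT2 hη₁half hRN')
  -- the Markov transfer along the flow (lower side)
  have hmain := measure_timeIntegral_pairFunctional_lt_le (u := u) hσ2 ha hθ hΞc hΞ0 hΞC hr N (Φ N) hχ hχ0 hχC hτ hη he
  refine hmain.trans (ENNReal.ofReal_le_ofReal ?_)
  rw [hε₀def, div_le_iff₀ hη]
  have hC1 : 0 < Cχ + 1 := by linarith
  have e : τ * (Cχ * (δ * η / (τ * (Cχ + 1)))) = δ * η * (Cχ / (Cχ + 1)) := by field_simp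
  rw [e]
  have hfrac : Cχ / (Cχ + 1) ≤ 1 := (div_le_one hC1).2 (by linarith)
  nlinarith [mul_pos hδ hη]

/-- **Two-sided form** (union of `pairFunctional_upper_inProb_rung0` and `pairFunctional_lower_inProb_rung0` at confidence `δ/2` each):
eventually in `N`, `G_N {z | η < |∫₀^τ∫ χ B_r Ξ (Φ_s z, ·) − Θ̄_Ξ ∫₀^τ∫χ|} ≤ δ`. [folklore] -/
theorem pairFunctional_abs_inProb_rung0 {σ a θ : ℝ} {u : V3} (hsd : SmallDensity uniformProfile σ) (ha : 0 < a) (hθ : 0 < θ)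
    (Φ : (N : ℕ) → HardSphereFlow (Torus.geometry (Fin 3)) (hsDiameter σ N) (N + 1)) {τ : ℝ} (hτ : 0 < τ)
    {χ : ℝ × T3 → ℝ} (hχ : Continuous χ) (hχ0 : ∀ p, 0 ≤ χ p)
    {Ξ : V3 × V3 × V3 → ℝ} (hΞc : Continuous Ξ) (hΞ0 : ∀ q, 0 ≤ Ξ q) {C : ℝ} (hΞC : ∀ q, Ξ q ≤ C)
    {r : ℝ} (hr : 0 < r) (hr2 : r < 1 / 2) {η δ : ℝ} (hη : 0 < η) (hδ : 0 < δ) :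
    ∃ N₀ : ℕ, ∀ N : ℕ, N₀ ≤ N →
      localGibbsLaw σ (fun _ => a) (fun _ => u) (fun _ => θ) N (Φ N)
        {z | η < |(∫ s in Icc (0 : ℝ) τ, ∫ x : T3, χ (s, x) * pairFunctional r Ξ ((Φ N).flow s z) x) -
            (∫ p, sphereMark Ξ p.1 p.2 ∂((gaussMeasure u θ).prod (gaussMeasure u θ))) *
              (∫ s in Icc (0 : ℝ) τ, ∫ x : T3, χ (s, x))|} ≤ ENNReal.ofReal δ := by
  obtain ⟨N₁, hN₁⟩ := pairFunctional_upper_inProb_rung0 (u := u) hsd ha hθ Φ hτ hχ hχ0 hΞc hΞ0 hΞC hr hr2 hη (half_pos hδ)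
  obtain ⟨N₂, hN₂⟩ := pairFunctional_lower_inProb_rung0 (u := u) hsd ha hθ Φ hτ hχ hχ0 hΞc hΞ0 hΞC hr hr2 hη (half_pos hδ)
  refine ⟨max N₁ N₂, fun N hN => ?_⟩
  have h1 := hN₁ N ((le_max_left _ _).trans hN)
  have h2 := hN₂ N ((le_max_right _ _).trans hN)
  set Θb : ℝ := ∫ p, sphereMark Ξ p.1 p.2 ∂((gaussMeasure u θ).prod (gaussMeasure u θ)) with hΘb
  set g : ℝ := ∫ s in Icc (0 : ℝ) τ, ∫ x : T3, χ (s, x) with hg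
  have hsub : {z : Config (N + 1) (Fin 3) T3 | η < |(∫ s in Icc (0 : ℝ) τ, ∫ x : T3, χ (s, x) * pairFunctional r Ξ ((Φ N).flow s z) x) -
        Θb * g|} ⊆
      {z | Θb * g + η < ∫ s in Icc (0 : ℝ) τ, ∫ x : T3, χ (s, x) * pairFunctional r Ξ ((Φ N).flow s z) x} ∪
      {z | ∫ s in Icc (0 : ℝ) τ, ∫ x : T3, χ (s, x) * pairFunctional r Ξ ((Φ N).flow s z) x < Θb * g - η} := by
    intro z hz
    simp only [Set.mem_setOf_eq, Set.mem_union] at hz ⊢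
    rcases lt_abs.1 hz with h | h
    · left; linarith
    · right; linarith
  calc localGibbsLaw σ (fun _ => a) (fun _ => u) (fun _ => θ) N (Φ N) _
      ≤ localGibbsLaw σ (fun _ => a) (fun _ => u) (fun _ => θ) N (Φ N) (_ ∪ _) := measure_mono hsub
    _ ≤ localGibbsLaw σ (fun _ => a) (fun _ => u) (fun _ => θ) N (Φ N) _ +
          localGibbsLaw σ (fun _ => a) (fun _ => u) (fun _ => θ) N (Φ N) _ := measure_union_le _ _
    _ ≤ ENNReal.ofReal (δ / 2) + ENNReal.ofReal (δ / 2) := add_le_add h1 h2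
    _ = ENNReal.ofReal δ := by
        rw [← ENNReal.ofReal_add (half_pos hδ).le (half_pos hδ).le, add_halves]

/-- **Closed signature form** of the lower bound (helper of crux stmt-AtomisticToContinuum-13080; the rung-0 B-side input through which the
door's reference mean `M_{r,N}` and the empirical functional are compared). [folklore] -/
theorem stub_pairFunctionalLowerInProbRung0 : ∀ (σ a θ : ℝ) (u : V3), SmallDensity uniformProfile σ → 0 < a → 0 < θ → ∀ (Φ : (N : ℕ) → HardSphereFlow (Torus.geometry (Fin 3)) (hsDiameter σ N) (N + 1)) (τ : ℝ), 0 < τ → ∀ (χ : ℝ × T3 → ℝ), Continuous χ → (∀ p, 0 ≤ χ p) → ∀ (Ξ : V3 × V3 × V3 → ℝ), Continuous Ξ → (∀ q, 0 ≤ Ξ q) → ∀ (C : ℝ), (∀ q, Ξ q ≤ C) → ∀ (r : ℝ), 0 < r → r < 1 / 2 → ∀ (η δ : ℝ), 0 < η → 0 < δ → ∃ N₀ : ℕ, ∀ N : ℕ, N₀ ≤ N → localGibbsLaw σ (fun _ => a) (fun _ => u) (fun _ => θ) N (Φ N) {z | ∫ s in Set.Icc (0 : ℝ) τ, ∫ x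 : T3, χ (s, x) * pairFunctional r Ξ ((Φ N).flow s z) x < (∫ p, sphereMark Ξ p.1 p.2 ∂((gaussMeasure u θ).prod (gaussMeasure u θ))) * (∫ s in Set.Icc (0 : ℝ) τ, ∫ x : T3, χ (s, x)) - η} ≤ ENNReal.ofReal δ :=
  fun _σ _a _θ u hsd ha hθ Φ _τ hτ _χ hχ hχ0 _Ξ hΞc hΞ0 _C hΞC _r hr hr2 _η _δ hη hδ =>
    pairFunctional_lower_inProb_rung0 (u := u) hsd ha hθ Φ hτ hχ hχ0 hΞc hΞ0 hΞC hr hr2 hη hδ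

end RateFloorPairFunctionalLower

end Summit.AtomisticToContinuum.HydrodynamicLimit.Theorems

end
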